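import Summits.ResolutionOfSingularities.ResolutionOfSingularities.Theorems.FrobeniusLadderFInjectiveMacaulayficationT11Char3HeadlinePsi
import Summits.ResolutionOfSingularities.ResolutionOfSingularities.Theorems.FrobeniusLadderFInjectiveMacaulayficationT11Char3Level2Block
import Summits.ResolutionOfSingularities.ResolutionOfSingularities.Theorems.FrobeniusLadderFInjectiveMacaulayficationT11Char3CellsAll
import Summits.ResolutionOfSingularities.ResolutionOfSingularities.Theorems.FrobeniusLadderFInjectiveMacaulayficationT11Char3R3Data
import Summits.ResolutionOfSingularities.ResolutionOfSingularities.Theorems.FrobeniusLadderFInjectiveMacaulayficationT11Char3R3Cover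
import HarnessLib

/-!
# ★ THE E7 INSTANCE `T₁₁ / 3`: the crux conclusion for `X = T₁₁⁺ ⊂ 𝔸⁵_k` over EVERY field `k` of characteristic 3, UNCONDITIONAL
# (crux `FInjectiveMacaulayfication` stmt-ResolutionOfSingularities-15315, chain w45a; K4.5 at the brief prime p = 3 — the TWO-LEVEL case)

[OURS · L1 W4.5a · res-L1-w45a-lead-1 gen 5] Support file (`--supports stmt-ResolutionOfSingularities-15315 --as helper`); NOT a statement of
any manuscript; AI-built, weaker than expert review; no statement of the manuscript is used. The certificate mathematics is res-L1-w45a-tri-1's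
(`cert-T11-p3-tower.v1.json` 9b80b52d9fdbabd6): at `p = 3` the 87-chart toric modification Σ_own of `T₁₁ = z² + (y²+x³)³ + x¹¹ + w⁷` leaves a
bad CURVE `C̄` over the origin (hon charts 64/66, ideal `(y₀, y₂, y₃+1)` / `(y₀, y₁, y₂+1)`), and the blowing up of `C̄` is clean: a two-level
tower. Assembly = `T11Char3Frame.fInjectiveMacaulayfication_T11plus_char3_of_data'` (lead-1: `TwoLevelRoadFrame` over `TwoLevelFrame`) on
(i) the LEVEL-1 model clauses `T11Char3CellsAll.hstd/hoff` (res-L1-w45a-stub-4's p = 3 cell texts through res-L1-w45a-stub-5's producers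
`T11Char3Poly.hon3_of_cells(_off)`), (ii) the CURVE DATA `hR3_of_data` below, assembled from res-type-034's R3 data half (`T11Char3R3Data`,
`T11Char3R3Cover` over `AffineBlowupChartRestriction` / `ChartModelNumerators` / `ChartModelReadings`), (iii) the LEVEL-2 blocks
`T11Char3Level2Block.hblock64/hblock66` (lead-1, on stub-4's `T11Char3Level2` data and `LineBlowupFan4`). [folklore glue; cite: Fedder1983, Prop. 1.7 and Thm. 1.12]
-/

-- single-problem summit: the doubled namespace component is forced
set_option linter.dupNamespace false

noncomputable section

namespace Summit.ResolutionOfSingularities.ResolutionOfSingularities.Theorems.FInjectiveMacaulayfication.T11OriginPointFixableChar3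

open AlgebraicGeometry CategoryTheory TopologicalSpace Literature.AlgebraicGeometry.Resolution MvPolynomial
open Summit.ResolutionOfSingularities.ResolutionOfSingularities.Theorems.FInjectiveMacaulayfication

set_option maxHeartbeats 1600000 in
/-- **The curve data `hR3` of the T₁₁/3 frame, assembled from res-type-034's R3 data half** (recipe `R3-DATA-HALF-CONSUMER.md`; valid for ANY `f` through the origin — the curve data only see the fan and the chart tables): for any pinned
sections isomorphisms `e c` and any C1-presented `θ c`, the generic point `ξ` of the bad curve (`T11Char3R3Cover.exists_xi`, chart 64) lies over
the origin; (R3a) on the seven charts meeting the curve the curve's ideal read in `R̄[I/w_c]` is the model ideal (`T11Char3R3Data.ideal_closure_map_eq_*`,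
equalities, used as `≤`); (R3b) the equalities on the hon charts 64/66; (R3c) `closure {ξ} ⊆ U 64 ∪ U 66` (`T11Char3R3Cover.hScover`, with the
Rees cover from `T11Char3Frame.reesCover_of_fanCover`). [folklore glue] -/
theorem hR3_of_data (k : Type) [Field k] [CharP k 3] (f : MvPolynomial (Fin 4) k) (hf0 : constantCoeff f = 0) :
    ∀ (e : ∀ c : Fin 87, Γ(affineBlowup (Ideal.span ((fun e : Fin 4 →₀ ℕ => Ideal.Quotient.mk (Ideal.span {f}) (monomial e (1 : k))) '' (T11Char7Fan.A : Set (Fin 4 →₀ ℕ)))), (Proj.basicOpen (reesGrading (Ideal.span ((fun e : Fin 4 →₀ ℕ => Ideal.Quotient.mk (Ideal.span {f}) (monomial e (1 : k))) '' (T11Char7Fan.A : Set (Fin 4 →₀ ℕ))))) (reesT (I := (Ideal.span ((fun e : Fin 4 →₀ ℕ => Ideal.Quotient.mk (Ideal.span {f}) (monomial e (1 : k))) '' (T11Char7Fan.A : Set (Fin 4 →₀ ℕ))))) (Ideal.Quotient.mk (Ideal.span {f}) (monomial (T11Char7Fan.m c) (1 : k))) (Ideal.subset_span ⟨T11Char7Fan.m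 c, T11Char7Fan.hmA c, rfl⟩ : (Ideal.Quotient.mk (Ideal.span {f}) (monomial (T11Char7Fan.m c) (1 : k))) ∈ (Ideal.span ((fun e : Fin 4 →₀ ℕ => Ideal.Quotient.mk (Ideal.span {f}) (monomial e (1 : k))) '' (T11Char7Fan.A : Set (Fin 4 →₀ ℕ)))))))) ≃+* ↥(blowupAlgebra (Ideal.span ((fun e : Fin 4 →₀ ℕ => Ideal.Quotient.mk (Ideal.span {f}) (monomial e (1 : k))) '' (T11Char7Fan.A : Set (Fin 4 →₀ ℕ)))) (Ideal.Quotient.mk (Ideal.span {f}) (monomial (T11Char7Fan.m c) (1 : k)))))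
      (he₀ : ∀ (c : Fin 87) (gg : HomogeneousLocalization.Away (reesGrading (Ideal.span ((fun e : Fin 4 →₀ ℕ => Ideal.Quotient.mk (Ideal.span {f}) (monomial e (1 : k))) '' (T11Char7Fan.A : Set (Fin 4 →₀ ℕ))))) (reesT (I := (Ideal.span ((fun e : Fin 4 →₀ ℕ => Ideal.Quotient.mk (Ideal.span {f}) (monomial e (1 : k))) '' (T11Char7Fan.A : Set (Fin 4 →₀ ℕ))))) (Ideal.Quotient.mk (Ideal.span {f}) (monomial (T11Char7Fan.m c) (1 : k))) (Ideal.subset_span ⟨T11Char7Fan.m c, T11Char7Fan.hmA c, rfl⟩ : (Ideal.Quotient.mk (Ideal.span {f}) (monomial (T11Char7Fan.m c) (1 : k))) ∈ (Ideal.span ((fun e : Fin 4 →₀ ℕ => Ideal.Quotient.mk (Ideal.span {f}) (monomial e (1 : k))) '' (T11Char7Fan.A : Set (Fin 4 →₀ ℕ))))))),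
        e c ((Proj.basicOpenIsoAway (reesGrading (Ideal.span ((fun e : Fin 4 →₀ ℕ => Ideal.Quotient.mk (Ideal.span {f}) (monomial e (1 : k))) '' (T11Char7Fan.A : Set (Fin 4 →₀ ℕ))))) (reesT (I := (Ideal.span ((fun e : Fin 4 →₀ ℕ => Ideal.Quotient.mk (Ideal.span {f}) (monomial e (1 : k))) '' (T11Char7Fan.A : Set (Fin 4 →₀ ℕ))))) (Ideal.Quotient.mk (Ideal.span {f}) (monomial (T11Char7Fan.m c) (1 : k))) (Ideal.subset_span ⟨T11Char7Fan.m c, T11Char7Fan.hmA c, rfl⟩ : (Ideal.Quotient.mk (Ideal.span {f}) (monomial (T11Char7Fan.m c) (1 : k))) ∈ (Ideal.span ((fun e : Fin 4 →₀ ℕ => Ideal.Quotient.mk (Ideal.span {f}) (monomial e (1 : k))) '' (T11Char7Fan.A : Set (Fin 4 →₀ ℕ)))))) (reesT_mem (Ideal.Quotient.mk (Ideal.span {f}) (monomial (T11Char7Fan.m c) (1 : k))) (Ideal.subset_span ⟨T11Char7Fan.m c, T11Char7Fan.hmA c, rfl⟩ : (Ideal.Quotient.mk (Ideal.span {f}) (monomial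 (T11Char7Fan.m c) (1 : k))) ∈ (Ideal.span ((fun e : Fin 4 →₀ ℕ => Ideal.Quotient.mk (Ideal.span {f}) (monomial e (1 : k))) '' (T11Char7Fan.A : Set (Fin 4 →₀ ℕ)))))) Nat.one_pos).hom gg) =
          reesChartEquiv (Ideal.Quotient.mk (Ideal.span {f}) (monomial (T11Char7Fan.m c) (1 : k))) (Ideal.subset_span ⟨T11Char7Fan.m c, T11Char7Fan.hmA c, rfl⟩ : (Ideal.Quotient.mk (Ideal.span {f}) (monomial (T11Char7Fan.m c) (1 : k))) ∈ (Ideal.span ((fun e : Fin 4 →₀ ℕ => Ideal.Quotient.mk (Ideal.span {f}) (monomial e (1 : k))) '' (T11Char7Fan.A : Set (Fin 4 →₀ ℕ))))) gg)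
      (θ : ∀ c : Fin 87, (MvPolynomial (Fin 4) k ⧸ Ideal.span {(KLocCellKit.evalL k (T11Char7Poly.G c))}) ≃+* ↥(blowupAlgebra (Ideal.span ((fun e : Fin 4 →₀ ℕ => Ideal.Quotient.mk (Ideal.span {f}) (monomial e (1 : k))) '' (T11Char7Fan.A : Set (Fin 4 →₀ ℕ)))) (Ideal.Quotient.mk (Ideal.span {f}) (monomial (T11Char7Fan.m c) (1 : k)))))
      (hθ : ∀ (c : Fin 87) (q : MvPolynomial (Fin 4) k), ((θ c (Ideal.Quotient.mk (Ideal.span {(KLocCellKit.evalL k (T11Char7Poly.G c))}) q)) :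
          Localization.Away (Ideal.Quotient.mk (Ideal.span {f}) (monomial (T11Char7Fan.m c) (1 : k)))) = aeval (fun i : Fin 4 => algebraMap (MvPolynomial (Fin 4) k ⧸ Ideal.span {f}) (Localization.Away (Ideal.Quotient.mk (Ideal.span {f}) (monomial (T11Char7Fan.m c) (1 : k))))
            (Ideal.Quotient.mk (Ideal.span {f}) (monomial (T11Char7Fan.a c i) (1 : k))) * IsLocalization.Away.invSelf (Ideal.Quotient.mk (Ideal.span {f}) (monomial (T11Char7Fan.m c) (1 : k)))) q),
      ∃ ξ : ↥(affineBlowup (Ideal.span ((fun e : Fin 4 →₀ ℕ => Ideal.Quotient.mk (Ideal.span {f}) (monomial e (1 : k))) '' (T11Char7Fan.A : Set (Fin 4 →₀ ℕ))))), (affineBlowup.π (Ideal.span ((fun e : Fin 4 →₀ ℕ => Ideal.Quotient.mk (Ideal.span {f}) (monomial e (1 : k))) '' (T11Char7Fan.A : Set (Fin 4 →₀ ℕ))))).base ξ = (⟨Ideal.span (Set.range fun i : Fin 4 => Ideal.Quotient.mk (Ideal.span {f}) (X i)), (T11Char3Frame.origin_isMaximal f hf0).isPrime⟩ : ↥(Spec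 (.of (MvPolynomial (Fin 4) k ⧸ Ideal.span {f})))) ∧
        (∀ c : Fin 87, T11Char3Poly.SSoff c ≠ [] → ((Scheme.IdealSheafData.vanishingIdeal (⟨closure ({ξ} : Set ↥(affineBlowup (Ideal.span ((fun e : Fin 4 →₀ ℕ => Ideal.Quotient.mk (Ideal.span {f}) (monomial e (1 : k))) '' (T11Char7Fan.A : Set (Fin 4 →₀ ℕ)))))), isClosed_closure⟩ : Closeds ↥(affineBlowup (Ideal.span ((fun e : Fin 4 →₀ ℕ => Ideal.Quotient.mk (Ideal.span {f}) (monomial e (1 : k))) '' (T11Char7Fan.A : Set (Fin 4 →₀ ℕ))))))).ideal (⟨(Proj.basicOpen (reesGrading (Ideal.span ((fun e : Fin 4 →₀ ℕ => Ideal.Quotient.mk (Ideal.span {f}) (monomial e (1 : k))) '' (T11Char7Fan.A : Set (Fin 4 →₀ ℕ))))) (reesT (I := (Ideal.span ((fun e : Fin 4 →₀ ℕ => Ideal.Quotient.mk (Ideal.span {f}) (monomial e (1 : k))) '' (T11Char7Fan.A : Set (Fin 4 →₀ ℕ))))) (Ideal.Quotient.mk (Ideal.span {f}) (monomial (T11Char7Fan.m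 c) (1 : k))) (Ideal.subset_span ⟨T11Char7Fan.m c, T11Char7Fan.hmA c, rfl⟩ : (Ideal.Quotient.mk (Ideal.span {f}) (monomial (T11Char7Fan.m c) (1 : k))) ∈ (Ideal.span ((fun e : Fin 4 →₀ ℕ => Ideal.Quotient.mk (Ideal.span {f}) (monomial e (1 : k))) '' (T11Char7Fan.A : Set (Fin 4 →₀ ℕ))))))), AffineBlowupChartFrame.isAffineOpen_basicOpen_reesT (Ideal.span ((fun e : Fin 4 →₀ ℕ => Ideal.Quotient.mk (Ideal.span {f}) (monomial e (1 : k))) '' (T11Char7Fan.A : Set (Fin 4 →₀ ℕ)))) (Ideal.Quotient.mk (Ideal.span {f}) (monomial (T11Char7Fan.m c) (1 : k))) (Ideal.subset_span ⟨T11Char7Fan.m c, T11Char7Fan.hmA c, rfl⟩ : (Ideal.Quotient.mk (Ideal.span {f}) (monomial (T11Char7Fan.m c) (1 : k))) ∈ (Ideal.span ((fun e : Fin 4 →₀ ℕ => Ideal.Quotient.mk (Ideal.span {f}) (monomial e (1 : k))) '' (T11Char7Fan.A : Set (Fin 4 →₀ ℕ)))))⟩ : (affineBlowup (Ideal.span ((fun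 e : Fin 4 →₀ ℕ => Ideal.Quotient.mk (Ideal.span {f}) (monomial e (1 : k))) '' (T11Char7Fan.A : Set (Fin 4 →₀ ℕ))))).affineOpens)).map (e c) ≤ (((Ideal.span {x | x ∈ (T11Char3Poly.HS c).map (KLocCellKit.evalL k)}).map (Ideal.Quotient.mk (Ideal.span {(KLocCellKit.evalL k (T11Char7Poly.G c))})))).map (θ c)) ∧
        ((Scheme.IdealSheafData.vanishingIdeal (⟨closure ({ξ} : Set ↥(affineBlowup (Ideal.span ((fun e : Fin 4 →₀ ℕ => Ideal.Quotient.mk (Ideal.span {f}) (monomial e (1 : k))) '' (T11Char7Fan.A : Set (Fin 4 →₀ ℕ)))))), isClosed_closure⟩ : Closeds ↥(affineBlowup (Ideal.span ((fun e : Fin 4 →₀ ℕ => Ideal.Quotient.mk (Ideal.span {f}) (monomial e (1 : k))) '' (T11Char7Fan.A : Set (Fin 4 →₀ ℕ))))))).ideal (⟨(Proj.basicOpen (reesGrading (Ideal.span ((fun e : Fin 4 →₀ ℕ => Ideal.Quotient.mk (Ideal.span {f}) (monomial e (1 : k))) '' (T11Char7Fan.A : Set (Fin 4 →₀ ℕ)))))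 (reesT (I := (Ideal.span ((fun e : Fin 4 →₀ ℕ => Ideal.Quotient.mk (Ideal.span {f}) (monomial e (1 : k))) '' (T11Char7Fan.A : Set (Fin 4 →₀ ℕ))))) (Ideal.Quotient.mk (Ideal.span {f}) (monomial (T11Char7Fan.m 64) (1 : k))) (Ideal.subset_span ⟨T11Char7Fan.m 64, T11Char7Fan.hmA 64, rfl⟩ : (Ideal.Quotient.mk (Ideal.span {f}) (monomial (T11Char7Fan.m 64) (1 : k))) ∈ (Ideal.span ((fun e : Fin 4 →₀ ℕ => Ideal.Quotient.mk (Ideal.span {f}) (monomial e (1 : k))) '' (T11Char7Fan.A : Set (Fin 4 →₀ ℕ))))))), AffineBlowupChartFrame.isAffineOpen_basicOpen_reesT (Ideal.span ((fun e : Fin 4 →₀ ℕ => Ideal.Quotient.mk (Ideal.span {f}) (monomial e (1 : k))) '' (T11Char7Fan.A : Set (Fin 4 →₀ ℕ)))) (Ideal.Quotient.mk (Ideal.span {f}) (monomial (T11Char7Fan.m 64) (1 : k))) (Ideal.subset_span ⟨T11Char7Fan.m 64, T11Char7Fan.hmA 64, rfl⟩ : (Ideal.Quotient.mk (Ideal.span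 {f}) (monomial (T11Char7Fan.m 64) (1 : k))) ∈ (Ideal.span ((fun e : Fin 4 →₀ ℕ => Ideal.Quotient.mk (Ideal.span {f}) (monomial e (1 : k))) '' (T11Char7Fan.A : Set (Fin 4 →₀ ℕ)))))⟩ : (affineBlowup (Ideal.span ((fun e : Fin 4 →₀ ℕ => Ideal.Quotient.mk (Ideal.span {f}) (monomial e (1 : k))) '' (T11Char7Fan.A : Set (Fin 4 →₀ ℕ))))).affineOpens)).map (e 64) = (((Ideal.span {x | x ∈ (T11Char3Poly.HS 64).map (KLocCellKit.evalL k)}).map (Ideal.Quotient.mk (Ideal.span {(KLocCellKit.evalL k (T11Char7Poly.G 64))})))).map (θ 64) ∧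
        ((Scheme.IdealSheafData.vanishingIdeal (⟨closure ({ξ} : Set ↥(affineBlowup (Ideal.span ((fun e : Fin 4 →₀ ℕ => Ideal.Quotient.mk (Ideal.span {f}) (monomial e (1 : k))) '' (T11Char7Fan.A : Set (Fin 4 →₀ ℕ)))))), isClosed_closure⟩ : Closeds ↥(affineBlowup (Ideal.span ((fun e : Fin 4 →₀ ℕ => Ideal.Quotient.mk (Ideal.span {f}) (monomial e (1 : k))) '' (T11Char7Fan.A : Set (Fin 4 →₀ ℕ))))))).ideal (⟨(Proj.basicOpen (reesGrading (Ideal.span ((fun e : Fin 4 →₀ ℕ => Ideal.Quotient.mk (Ideal.span {f}) (monomial e (1 : k))) '' (T11Char7Fan.A : Set (Fin 4 →₀ ℕ))))) (reesT (I := (Ideal.span ((fun e : Fin 4 →₀ ℕ => Ideal.Quotient.mk (Ideal.span {f}) (monomial e (1 : k))) '' (T11Char7Fan.A : Set (Fin 4 →₀ ℕ))))) (Ideal.Quotient.mk (Ideal.span {f}) (monomial (T11Char7Fan.m 66) (1 : k))) (Ideal.subset_span ⟨T11Char7Fan.m 66, T11Char7Fan.hmA 66, rfl⟩ : (Ideal.Quotient.mk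 (Ideal.span {f}) (monomial (T11Char7Fan.m 66) (1 : k))) ∈ (Ideal.span ((fun e : Fin 4 →₀ ℕ => Ideal.Quotient.mk (Ideal.span {f}) (monomial e (1 : k))) '' (T11Char7Fan.A : Set (Fin 4 →₀ ℕ))))))), AffineBlowupChartFrame.isAffineOpen_basicOpen_reesT (Ideal.span ((fun e : Fin 4 →₀ ℕ => Ideal.Quotient.mk (Ideal.span {f}) (monomial e (1 : k))) '' (T11Char7Fan.A : Set (Fin 4 →₀ ℕ)))) (Ideal.Quotient.mk (Ideal.span {f}) (monomial (T11Char7Fan.m 66) (1 : k))) (Ideal.subset_span ⟨T11Char7Fan.m 66, T11Char7Fan.hmA 66, rfl⟩ : (Ideal.Quotient.mk (Ideal.span {f}) (monomial (T11Char7Fan.m 66) (1 : k))) ∈ (Ideal.span ((fun e : Fin 4 →₀ ℕ => Ideal.Quotient.mk (Ideal.span {f}) (monomial e (1 : k))) '' (T11Char7Fan.A : Set (Fin 4 →₀ ℕ)))))⟩ : (affineBlowup (Ideal.span ((fun e : Fin 4 →₀ ℕ => Ideal.Quotient.mk (Ideal.span {f}) (monomial e (1 : k))) '' (T11Char7Fan.A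 : Set (Fin 4 →₀ ℕ))))).affineOpens)).map (e 66) = (((Ideal.span {x | x ∈ (T11Char3Poly.HS 66).map (KLocCellKit.evalL k)}).map (Ideal.Quotient.mk (Ideal.span {(KLocCellKit.evalL k (T11Char7Poly.G 66))})))).map (θ 66) ∧
        (∀ x' : ↥(affineBlowup (Ideal.span ((fun e : Fin 4 →₀ ℕ => Ideal.Quotient.mk (Ideal.span {f}) (monomial e (1 : k))) '' (T11Char7Fan.A : Set (Fin 4 →₀ ℕ))))), x' ∈ closure ({ξ} : Set ↥(affineBlowup (Ideal.span ((fun e : Fin 4 →₀ ℕ => Ideal.Quotient.mk (Ideal.span {f}) (monomial e (1 : k))) '' (T11Char7Fan.A : Set (Fin 4 →₀ ℕ)))))) → ∃ c ∈ ({64, 66} : Set (Fin 87)), x' ∈ (Proj.basicOpen (reesGrading (Ideal.span ((fun e : Fin 4 →₀ ℕ => Ideal.Quotient.mk (Ideal.span {f}) (monomial e (1 : k))) '' (T11Char7Fan.A : Set (Fin 4 →₀ ℕ))))) (reesT (I := (Ideal.span ((fun e : Fin 4 →₀ ℕ => Ideal.Quotient.mk (Ideal.span {f}) (monomial e (1 :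 k))) '' (T11Char7Fan.A : Set (Fin 4 →₀ ℕ))))) (Ideal.Quotient.mk (Ideal.span {f}) (monomial (T11Char7Fan.m c) (1 : k))) (Ideal.subset_span ⟨T11Char7Fan.m c, T11Char7Fan.hmA c, rfl⟩ : (Ideal.Quotient.mk (Ideal.span {f}) (monomial (T11Char7Fan.m c) (1 : k))) ∈ (Ideal.span ((fun e : Fin 4 →₀ ℕ => Ideal.Quotient.mk (Ideal.span {f}) (monomial e (1 : k))) '' (T11Char7Fan.A : Set (Fin 4 →₀ ℕ)))))))) := by
  intro e he₀ θ hθ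
  have hbmax := T11Char3Frame.origin_isMaximal f hf0
  have hcover := T11Char3Frame.reesCover_of_fanCover f T11Char7Fan.A T11Char7Fan.m T11Char7Fan.hmA (T11Char7Fan.hcov k)
  obtain ⟨ξ, hξ64, h64, hξ⟩ := T11Char3R3Cover.exists_xi k f (e 64) (he₀ 64) (θ 64) (hθ 64)
    (⟨Ideal.span (Set.range fun i : Fin 4 => Ideal.Quotient.mk (Ideal.span {f}) (X i)), (T11Char3Frame.origin_isMaximal f hf0).isPrime⟩ :
      ↥(Spec (.of (MvPolynomial (Fin 4) k ⧸ Ideal.span {f})))) hbmax rfl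
  refine ⟨ξ, hξ, ?_, ?_, ?_, ?_⟩
  · -- (R3a) on the charts meeting the curve
    intro c hc
    rcases T11Char3R3Cover.chart_cases c with rfl | rfl | rfl | rfl | rfl | rfl | rfl | hnot
    · exact (T11Char3R3Data.ideal_closure_map_eq_64 k f (e 64) (θ 64) ξ hξ64 h64).le
    · obtain ⟨_, heq⟩ := T11Char3R3Data.ideal_closure_map_eq_66 k f (e 64) (he₀ 64) (θ 64) (hθ 64) (e 66) (he₀ 66) (θ 66) (hθ 66) ξ hξ64 h64
      exact heq.le
    · obtain ⟨_, heq⟩ := T11Char3R3Data.ideal_closure_map_eq_32 k f (e 64) (he₀ 64) (θ 64) (hθ 64) (e 32) (he₀ 32) (θ 32) (hθ 32) ξ hξ64 h64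
      exact heq.le
    · obtain ⟨_, heq⟩ := T11Char3R3Data.ideal_closure_map_eq_33 k f (e 64) (he₀ 64) (θ 64) (hθ 64) (e 33) (he₀ 33) (θ 33) (hθ 33) ξ hξ64 h64
      exact heq.le
    · obtain ⟨_, heq⟩ := T11Char3R3Data.ideal_closure_map_eq_65 k f (e 64) (he₀ 64) (θ 64) (hθ 64) (e 65) (he₀ 65) (θ 65) (hθ 65) ξ hξ64 h64
      exact heq.le
    · obtain ⟨_, heq⟩ := T11Char3R3Data.ideal_closure_map_eq_67 k f (e 64) (he₀ 64) (θ 64) (hθ 64) (e 67) (he₀ 67) (θ 67) (hθ 67) ξ hξ64 h64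
      exact heq.le
    · obtain ⟨_, heq⟩ := T11Char3R3Data.ideal_closure_map_eq_68 k f (e 64) (he₀ 64) (θ 64) (hθ 64) (e 68) (he₀ 68) (θ 68) (hθ 68) ξ hξ64 h64
      exact heq.le
    · exact absurd (T11Char3Poly.SSoff_eq_nil c hnot) hc
  · -- (R3b) chart 64
    exact T11Char3R3Data.ideal_closure_map_eq_64 k f (e 64) (θ 64) ξ hξ64 h64
  · -- (R3b) chart 66
    exact (T11Char3R3Data.ideal_closure_map_eq_66 k f (e 64) (he₀ 64) (θ 64) (hθ 64) (e 66) (he₀ 66) (θ 66) (hθ 66) ξ hξ64 h64).2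
  · -- (R3c) the hon charts cover the curve
    exact T11Char3R3Cover.hScover k f e he₀ θ hθ hcover ξ hξ64 h64

/-- **THE W4.5a INSTANCE T₁₁/3 — THE CRUX STATEMENT FOR `X = T₁₁⁺` OVER EVERY FIELD OF CHARACTERISTIC `3`, UNCONDITIONAL.**
`T₁₁⁺ = V(Φ − y² − x³, z² + Φ³ + x¹¹ + w⁷) ⊂ 𝔸⁵_k` has an F-injective Macaulayfication in the sense of the crux
`FrobeniusLadder.FInjectiveMacaulayfication`: a proper birational `π : X' → X` with every stalk of `X'` a domain in which every system of
parameters is weakly regular and generates a Frobenius-closed ideal. With `p = 7` (p525959) and `p = 5` (p534747) — one toric level each — this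
closes the brief's prime list for `T₁₁`; `p = 3` is the first TWO-LEVEL tower in the tree (the level-1 bad set is a curve, fixed by blowing it up).
[OURS · L1 W4.5a; the certificate mathematics is res-L1-w45a-tri-1's] -/
theorem fInjectiveMacaulayfication_T11plus_char3 (k : Type) [Field k] [CharP k 3] (Fs : Fin 2 → MvPolynomial (Fin 5) k)
    (hF₀ : Fs 0 = X 4 - X 1 ^ 2 - X 0 ^ 3) (hF₁ : Fs 1 = X 2 ^ 2 + X 4 ^ 3 + X 0 ^ 11 + X 3 ^ 7) :
    ∃ (X' : Scheme.{0}) (π : X' ⟶ (Spec (.of (MvPolynomial (Fin 5) k ⧸ Ideal.span (Set.range Fs))))),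
      IsProper π ∧ Literature.AlgebraicGeometry.Resolution.IsBirational π ∧
      ∀ x : X', IsDomain (X'.presheaf.stalk x) ∧ ∀ d : ℕ, ringKrullDim (X'.presheaf.stalk x) = d →
        ∀ s : Fin d → X'.presheaf.stalk x, (Ideal.span (Set.range s)).radical.IsMaximal →
          RingTheory.Sequence.IsWeaklyRegular (X'.presheaf.stalk x) (List.ofFn s) ∧
          ∀ y : X'.presheaf.stalk x, (∃ e : ℕ, y ^ 3 ^ e ∈
            Ideal.span ((fun z : X'.presheaf.stalk x => z ^ 3 ^ e) '' (Ideal.span (Set.range s) : Set (X'.presheaf.stalk x)))) →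
            y ∈ Ideal.span (Set.range s) :=
  have hf0 : constantCoeff (X 2 ^ 2 + (X 1 ^ 2 + X 0 ^ 3) ^ 3 + X 0 ^ 11 + X 3 ^ 7 : MvPolynomial (Fin 4) k) = 0 := by simp [constantCoeff_X]
  T11Char3Frame.fInjectiveMacaulayfication_T11plus_char3_of_data' k (X 2 ^ 2 + (X 1 ^ 2 + X 0 ^ 3) ^ 3 + X 0 ^ 11 + X 3 ^ 7 : MvPolynomial (Fin 4) k) rfl hf0
    (T11Char3CellsAll.hstd k) (T11Char3CellsAll.hoff k) (hR3_of_data k _ hf0)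
    (T11Char3Level2Block.hblock64 k) (T11Char3Level2Block.hblock66 k) Fs hF₀ hF₁

end Summit.ResolutionOfSingularities.ResolutionOfSingularities.Theorems.FInjectiveMacaulayfication.T11OriginPointFixableChar3

end
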